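import Summits.AtomisticToContinuum.Crystallization.Theorems.OverbindingBudgetBalancedCensus

/-!
# OverbindingBudget — the misfit census BALANCED against the chunk's own stress, III: the cones (decomp-a2c lens-4, generation 40)

Helper file (`--supports stmt-AtomisticToContinuum-31280`).  With the glue `misfitRelax_of_tameBalancedMisfitGap` (part II) and the seams of
part I, the RDEF cones of the balanced census:

* **CONE XLI-B** `rdef_of_ceg_tameBalancedMisfitGap : ChargedEnergyGap → TameBalancedMisfitGap (122/125) 0 → CleanlessExcessT → CoherentResidual 10
  → RobustDefectLimitWindows` (cone XLI-W with its census slot kernel-weakened by the stress rebate);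
* `rdef_of_ceg_tameBalancedScale_gapFree` (scale form + `GapFreeShells`);
* **CONE XLV** `rdef_of_ceg_shape_balancedDeep_gapFree : 0 ≤ ρ → ChargedEnergyGap → TwoShellShape (1/100) ε g →
  TameBalancedDeepScaleGap (122/125) 0 ρ ε g → GapFreeShells → CleanlessExcessT → CoherentResidual 10 → RobustDefectLimitWindows` (every depth
  `ρ ≥ 0`, every shape pair), its `∃ ρ` form, and the RECORD INSTANCE `rdef_of_ceg_shape_balancedDeep_gapFree_record` (`ρ = 4`, `ε = 3/50`,
  `g = 1/450`) — cone XLIV (`…MisfitWindow.rdef_of_ceg_shape_registered_gapFree`) with its one hard slot `RegisteredScaleGap (122/125) 0 4 (3/50)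
  (1/450)` replaced by the KERNEL-WEAKER `TameBalancedDeepScaleGap (122/125) 0 4 (3/50) (1/450)` (`coneXLV_of_coneXLIV_slot`), nothing added.
-/

namespace Summit.AtomisticToContinuum.Crystallization.Theorems.OverbindingBudgetBalancedCensusCones

open Literature.MathematicalPhysics.StatisticalMechanics
open Summit.AtomisticToContinuum.Crystallization.Theses.OverbindingBudget (RobustDefectLimitWindows)
open Summit.AtomisticToContinuum.Crystallization.Theses.PricedLinkCensus (ChargedEnergyGap)
open Summit.AtomisticToContinuum.Crystallization.Theorems.OverbindingBudgetGradedBareness (CleanlessExcessT)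
open Summit.AtomisticToContinuum.Crystallization.Theorems.OverbindingBudgetCoherentCut (CoherentResidual)
open Summit.AtomisticToContinuum.Crystallization.Theorems.OverbindingBudgetGrossMargin (GrossLiouvilleLaw)
open Summit.AtomisticToContinuum.Crystallization.Theorems.OverbindingBudgetMisfitCensusStatements (GapFreeShells MisfitRelax)
open Summit.AtomisticToContinuum.Crystallization.Theorems.OverbindingBudgetMisfitCensus (rdef_of_ceg_misfitRelax
  grossLiouvilleLaw_of_misfitRelax)
open Summit.AtomisticToContinuum.Crystallization.Theorems.OverbindingBudgetMisfitRegistration (RegisteredScaleGap)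
open Summit.AtomisticToContinuum.Crystallization.Theorems.OverbindingBudgetTwoShellShape (TwoShellShape)
open Summit.AtomisticToContinuum.Crystallization.Theorems.OverbindingBudgetBalancedCensusStatements
open Summit.AtomisticToContinuum.Crystallization.Theorems.OverbindingBudgetBalancedCensus (misfitRelax_of_tameBalancedMisfitGap)

/-! ## §H  Consequences and the cones (PROVED) -/

/-- The balanced tame census at an admissible spacing gives the gross Liouville law at every margin and core radius. [this file] -/
theorem grossLiouvilleLaw_of_tameBalancedMisfitGap {a T₀ D : ℝ} (ha : 47 / 50 ≤ a) (ha1 : a ≤ 1) (h : TameBalancedMisfitGap a 0) :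
    GrossLiouvilleLaw T₀ D :=
  grossLiouvilleLaw_of_misfitRelax ha ha1 (misfitRelax_of_tameBalancedMisfitGap (by linarith) ha1 h)

/-- **CONE XLI-B** — `ChargedEnergyGap → TameBalancedMisfitGap (122/125) 0 → CleanlessExcessT → CoherentResidual 10 → RobustDefectLimitWindows`
(cone XLI-W with its census slot KERNEL-WEAKENED by the stress rebate). [this file] -/
theorem rdef_of_ceg_tameBalancedMisfitGap (hCEG : ChargedEnergyGap) (hM : TameBalancedMisfitGap (122 / 125) 0) (hCE : CleanlessExcessT)
    (hRes : CoherentResidual 10) : RobustDefectLimitWindows :=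
  rdef_of_ceg_misfitRelax (a := 122 / 125) (by norm_num) (by norm_num) hCEG
    (misfitRelax_of_tameBalancedMisfitGap (by norm_num) (by norm_num) hM) hCE hRes

/-- `ChargedEnergyGap → TameBalancedScaleGap (122/125) 0 → GapFreeShells → CleanlessExcessT → CoherentResidual 10 → RobustDefectLimitWindows`.
[this file] -/
theorem rdef_of_ceg_tameBalancedScale_gapFree (hCEG : ChargedEnergyGap) (hS : TameBalancedScaleGap (122 / 125) 0) (hGF : GapFreeShells)
    (hCE : CleanlessExcessT) (hRes : CoherentResidual 10) : RobustDefectLimitWindows :=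
  rdef_of_ceg_tameBalancedMisfitGap hCEG (tameBalancedMisfitGap_zero_of_scale_gapFree hS hGF) hCE hRes

/-- **CONE XLV (parametric)** — `ChargedEnergyGap → TwoShellShape (1/100) ε g → TameBalancedDeepScaleGap (122/125) 0 ρ ε g → GapFreeShells →
CleanlessExcessT → CoherentResidual 10 → RobustDefectLimitWindows` for every depth `ρ ≥ 0` and every shape pair `(ε, g)`. [this file] -/
theorem rdef_of_ceg_shape_balancedDeep_gapFree {ρ ε g : ℝ} (hρ : 0 ≤ ρ) (hCEG : ChargedEnergyGap) (hT : TwoShellShape (1 / 100) ε g)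
    (hD : TameBalancedDeepScaleGap (122 / 125) 0 ρ ε g) (hGF : GapFreeShells) (hCE : CleanlessExcessT) (hRes : CoherentResidual 10) :
    RobustDefectLimitWindows :=
  rdef_of_ceg_tameBalancedMisfitGap hCEG (tameBalancedMisfitGap_of_shape_deep_gapFree hρ hT hD hGF) hCE hRes

/-- Cone XLV with the depth existentially quantified: SOME depth suffices. [this file] -/
theorem rdef_of_ceg_shape_someDeep_gapFree {ε g : ℝ} (hCEG : ChargedEnergyGap) (hT : TwoShellShape (1 / 100) ε g)
    (hD : ∃ ρ : ℝ, 0 ≤ ρ ∧ TameBalancedDeepScaleGap (122 / 125) 0 ρ ε g) (hGF : GapFreeShells) (hCE : CleanlessExcessT)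
    (hRes : CoherentResidual 10) : RobustDefectLimitWindows := by
  obtain ⟨ρ, hρ, hD⟩ := hD
  exact rdef_of_ceg_shape_balancedDeep_gapFree hρ hCEG hT hD hGF hCE hRes

/-- **CONE XLV — the record instance, SIX slots** (`ρ = 4`, `ε = 3/50`, `g = 1/450`): `ChargedEnergyGap → TwoShellShape (1/100) (3/50) (1/450) →
TameBalancedDeepScaleGap (122/125) 0 4 (3/50) (1/450) → GapFreeShells → CleanlessExcessT → CoherentResidual 10 → RobustDefectLimitWindows`.
Cone XLIV with its one hard slot replaced by a KERNEL-WEAKER one (`coneXLV_of_coneXLIV_slot`). [this file] -/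
theorem rdef_of_ceg_shape_balancedDeep_gapFree_record (hCEG : ChargedEnergyGap) (hT : TwoShellShape (1 / 100) (3 / 50) (1 / 450))
    (hD : TameBalancedDeepScaleGap (122 / 125) 0 4 (3 / 50) (1 / 450)) (hGF : GapFreeShells) (hCE : CleanlessExcessT)
    (hRes : CoherentResidual 10) : RobustDefectLimitWindows :=
  rdef_of_ceg_shape_balancedDeep_gapFree (by norm_num) hCEG hT hD hGF hCE hRes

/-- The new slot is implied by the old one: `RegisteredScaleGap (122/125) 0 4 (3/50) (1/450) → TameBalancedDeepScaleGap (122/125) 0 4 (3/50) (1/450)`.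
[this file] -/
theorem coneXLV_of_coneXLIV_slot (hR : RegisteredScaleGap (122 / 125) 0 4 (3 / 50) (1 / 450)) :
    TameBalancedDeepScaleGap (122 / 125) 0 4 (3 / 50) (1 / 450) :=
  tameBalancedDeepScaleGap_of_registered (by norm_num) hR

end Summit.AtomisticToContinuum.Crystallization.Theorems.OverbindingBudgetBalancedCensusCones
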